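/- Copyright: the b2b-balaban cell (near-miss cell 7), T⁴-continuum fan-out; row NE7b CRUX team (2), seat
t4-ne7b-formalise-leaf-02 (gen 25; the row owner's INTERFACE REQUEST NE7b IR-42-2 of ruling R-OWNER-42-2 «M5's cost side
is stated in TOTAL (lifeCost) form», `CLAIMS.log` l.29149, E-side part (E6T) — the apex witness over the memory-agnostic
carrier with the realised-cost fields READ IN TOTAL FORM).  Released under the licence of the surrounding project. -/
import Summits.QuantumFields.BalabanUV.T4Continuum.Support.HistoryRealiseCellsRunApexT3bW

/-!
# Realised histories: THE COUNT-ROAD WITNESS OVER END v3′, MEMORY-AGNOSTIC CARRIER, COST SIDE IN TOTAL FORM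
(`CountRoadWitnessT3bWT`; INTERFACE REQUEST NE7b IR-42-2, E-side, file E6T)

Summits-side support leaf of the T⁴-continuum cell (rung (B)+1 on a FINITE torus only; NOT infinite volume, NOT the
mass gap, NOT the Clay statement; NOT a proof of the spine estimate NE7b, which is the cell's OWN estimate, NOT PRINTED
and NOT PROVED).  Row NE7b, route «COUNT» ∕ R-P1, re-open object (α); row S12-W of
`t4/b2b-balaban-t4-ne7b-p1/LEAVES-NE7b.md`; the owner's IR-42-2 (`CLAIMS.log` l.29149, `HOME/INBOX.md` l.4594–4598) as
split by the S12-W custodian leaf-03 (`CLAIMS.log` l.29200: W-files → leaf-03, E-files → leaf-02): E6T = the total-form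
twin of this seat's E6 `HistoryRealiseCellsRunApexT3bW` (p251677).

WHY.  Ruling R-OWNER-42-2 (READING OF RECORD, kernel, by name): the END consumes the H3 cost binder
`cost_le : ∀ … q ∈ memOf …, ∀ m ∈ life (padW (dictWT Prod.fst (R K) C.n₁) 0) q.2, κ K q q.2 m ≤ costT Prod.fst C K (R K) q.2 m`
(E6 :191) ONLY through `lifeCostT_mono h = Finset.sum_le_sum h`, on the Mult road inside
`HistoryAssemblyMultProfile.pshapeTH_mul_exp_le_shapeTH_of_profile` (leaf-03's located plumbing fact, l.29200).  Hence
the TOTAL form `lifeCost (padW …) (κ K q) q.2 ≤ lifeCost (padW …) (costT …) q.2` is a drop-in WEAKER binder with the same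
consequence; the owner's located design observation O-M5-1 (a merger cascade realises several unit boxes at a step where
`costT` books ONE window floor, so the STEPWISE domination is not robustly supplied by the geometry, while the total form
is print's own per-region ∕ per-merger currency) is why the (α) brick M5-1 `HistoryGenealogyBankingCost` will supply the
total form and not the stepwise one.  THIS FILE re-types the apex witness accordingly: §1
**`structure CountRoadWitnessT3bWT`** = E6's `CountRoadWitnessT3bW` FIELD FOR FIELD, with the TWO cost fields
`cost_le`∕`cost_le'` read in total form (every other field TOKEN FOR TOKEN, `realised : RealisedDomainsRW …` included);
**`CountRoadWitnessT3bW.toT`** (E6's witness implies this one — `lifeCostT_mono`) and **`CountRoadWitnessT3b.toWT`**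
(the landed-carrier witness of the headline of record p224237 implies this one — `toW` then `toT`); §2
**`stringHybridNE7_of_hybridNE7T3bWT`** = the landed structure-free
`HistoryRealiseCellsRunApexT3b.stringHybridNE7_of_hybridNE7_repr` BY NAME on the WT-witness's data (the cost fields are
not read there).  The total-form W-HEADLINE (file E8T: hypothesis `CountRoadWitnessT3bWT`, conclusion byte-identical
with p224237's ∕ E8's) composes this file with the total-form W-pinned ENDs E4T∕E5T, which wait on leaf-03's W7T∕W9T
(`…CellsRunMultEndDWT`∕`…MultEndPDWT`, over its T0 `HistoryAssemblyMultProfileTotal` p256460); THIS file depends on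
none of them and is filed first.  Append-only: nothing landed is edited; E6 and its bridge `CountRoadWitnessT3b.toW` stay.

[folklore] ONE hypothesis SHAPE (a `Type`-valued record of data + displayed binders, twin of a landed shape; D-0009 lane)
+ two bridge `def`s + by-name compositions; NO `Prop`-valued fact of Bałaban's minted (trigger c1), nothing printed
asserted, no `[cite:]` tag, zero `sorry`.

HONEST.  A by-name WEAKENING of one displayed H3 binder of OUR bookkeeping (class R of the cost field UNCHANGED until the
owner's M5-1 discharges it); the reading H3^NE7b (W-form, total cost side), (B) and the BetaPertH-flow facts stay
DISPLAYED (FIELDS ∕ binders, not discharged); by-name class of every `WALL-NE7b-P1.md` §2 binder UNCHANGED; headline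
p224237 and the W-headline E8 (p255842) UNCHANGED BY NAME; located open point G-M4-1 untouched; NE7b NOT proved; spine
0∕9.  HONEST DEPENDENCY (cell): continuum YM on T⁴ ⇐ BetaPertH ∧ nine spine estimates (0/9 proved); BetaPertH ⇐ (D1) ∧
(D4) ∧ CAP+tail; G-an2-4 gates asym, D1 and NE2/3/4.  This file changes none of it. -/

open Finset MeasureTheory
open Literature.MathematicalPhysics.QuantumFieldTheory.Balaban1983to89
open T4PersistenceDictionary T4PersistentHistoryCount T4BankedInduction T4PrintedShapeBanking
open T4WeightBudget T4GlobalDenominator T4LiveClassFibration T4LiveStructureGas T4LiveGasToTerms T4RecordPriceSeam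
open T4PartnerMultiplicity T4IndicatorShell T4MatchingAssembly T4MatchingClosure T4MatchingClosureSocket T4Continuum
open T4StabilitySocket T4BranchingRecordsGas T4TaggedShapeBanking T4CanonicalMenus T4RenewalChains
open Summit.QuantumFields.BalabanUV.T4Continuum.PlacementBatch Summit.QuantumFields.BalabanUV.T4Continuum.PlacementSkeleton
open Summit.QuantumFields.BalabanUV.T4Continuum.CountThresholdUniform Summit.QuantumFields.BalabanUV.T4Continuum.CountThresholdExit
open Summit.QuantumFields.BalabanUV.T4Continuum.CountSeamJunction Summit.QuantumFields.BalabanUV.T4Continuum.LateMergers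
open Summit.QuantumFields.BalabanUV.T4Continuum.HistoryFlow Summit.QuantumFields.BalabanUV.T4Continuum.HistoryRegeneration
open Summit.QuantumFields.BalabanUV.T4Continuum.HistoryTables Summit.QuantumFields.BalabanUV.T4Continuum.HistoryAssemblyTrees
open Summit.QuantumFields.BalabanUV.T4Continuum.HistoryAssemblyTerms Summit.QuantumFields.BalabanUV.T4Continuum.HistoryAssemblyPedigree
open Summit.QuantumFields.BalabanUV.T4Continuum.HistoryConstants Summit.QuantumFields.BalabanUV.T4Continuum.HistoryGen
open Literature.MathematicalPhysics.QuantumFieldTheory.Balaban1983to89.B13ScaleTransfer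
open Summit.QuantumFields.BalabanUV.T4Continuum.ZoneSkeleton Summit.QuantumFields.BalabanUV.T4Continuum.HistorySocketTH
open Summit.QuantumFields.BalabanUV.T4Continuum.HistoryCaps Summit.QuantumFields.BalabanUV.T4Continuum.HistoryAssemblyPrice
open Summit.QuantumFields.BalabanUV.T4Continuum.HistoryBankingLE Summit.QuantumFields.BalabanUV.T4Continuum.HistoryExitLE
open Summit.QuantumFields.BalabanUV.T4Continuum.HistoryAssemblyTreesLE Summit.QuantumFields.BalabanUV.T4Continuum.HistoryAssemblyTermsLE
open Summit.QuantumFields.BalabanUV.T4Continuum.HistoryRealise Summit.QuantumFields.BalabanUV.T4Continuum.HistoryAssemblyRealiseLE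
open Summit.QuantumFields.BalabanUV.T4Continuum.HistoryAssemblyMult Summit.QuantumFields.BalabanUV.T4Continuum.HistoryAssemblyMultKey
open Summit.QuantumFields.BalabanUV.T4Continuum.HistoryAssemblyRealiseRun Summit.QuantumFields.BalabanUV.T4Continuum.HistoryAssemblyRealiseMult
open Summit.QuantumFields.BalabanUV.T4Continuum.HistoryZones Summit.QuantumFields.BalabanUV.T4Continuum.HistoryRealiseCells
open Summit.QuantumFields.BalabanUV.T4Continuum.HistoryRealiseCellsRun Summit.QuantumFields.BalabanUV.T4Continuum.HistoryAssemblyRealiseRunMult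
open Summit.QuantumFields.BalabanUV.T4Continuum.HistoryRealiseCellsRunMult Summit.QuantumFields.BalabanUV.T4Continuum.HistoryAssemblyMultInstance
open Summit.QuantumFields.BalabanUV.T4Continuum.HistoryJoinsPlacedMember Summit.QuantumFields.BalabanUV.T4Continuum.PlacementSkeleton
open Summit.QuantumFields.BalabanUV.T4Continuum.HistoryJoinsPlacedMult Summit.QuantumFields.BalabanUV.T4Continuum.HistoryRealiseDistinct
open Summit.QuantumFields.BalabanUV.T4Continuum.HistoryRegionTemplates Summit.QuantumFields.BalabanUV.T4Continuum.HistoryCaps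
open Summit.QuantumFields.BalabanUV.T4Continuum.HistoryZoneEvolve (cth)
open Literature.MathematicalPhysics.QuantumFieldTheory.Balaban1983to89.B16SProfile (DropCtl)
open Summit.QuantumFields.BalabanUV.T4Continuum.HistoryRealiseCellsRunMultEnd Summit.QuantumFields.BalabanUV.T4Continuum.HistoryRealiseCellsRunMultEndD
open Summit.QuantumFields.BalabanUV.T4Continuum.HistoryRealiseCellsRunPinnedT3b Summit.QuantumFields.BalabanUV.T4Continuum.HistoryHybridRescale
open Summit.QuantumFields.BalabanUV.T4Continuum.HistoryRealiseCellsRunApex (exists_const_schemeZ)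
open Summit.QuantumFields.BalabanUV.T4Continuum.HistoryRealisePrint Summit.QuantumFields.BalabanUV.T4Continuum.HistoryRealiseWeak
open Summit.QuantumFields.BalabanUV.T4Continuum.HistoryRealisePrintReading
open Summit.QuantumFields.BalabanUV.T4Continuum.HistoryRealiseWeakReading
open Summit.QuantumFields.BalabanUV.T4Continuum.HistoryRealisePrintCells Summit.QuantumFields.BalabanUV.T4Continuum.HistoryRealiseWeakCells
open Summit.QuantumFields.BalabanUV.T4Continuum.HistoryRealiseCellsRunApexT3b
open Summit.QuantumFields.BalabanUV.T4Continuum.HistoryRealiseCellsRunApexT3bW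

namespace Summit.QuantumFields.BalabanUV.T4Continuum.HistoryRealiseCellsRunApexT3bWT

noncomputable section

section Apex

variable {F : T4Family} {G : Type*} [GaugeGroup G] [MeasurableSpace G] [HaarData G] [RegularGaugeGroup G]

/-! ## §1 The witness with the cost side in total form, and the bridges from E6's witness and the landed witness -/

/-- **A COUNT-ROAD WITNESS OVER THE END OF RECORD v3′, MEMORY-AGNOSTIC CARRIER, COST SIDE IN TOTAL FORM** for the tuned
run `g₀` and the loop string `os` (HYPOTHESIS SHAPE — data + END v3′'s displayed binders, NOTHING asserted): E6's
`HistoryRealiseCellsRunApexT3bW.CountRoadWitnessT3bW` (p251677) FIELD FOR FIELD, with the TWO H3 realised-cost fields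
re-read in TOTAL (lifeCost) form per ruling R-OWNER-42-2 ∕ IR-42-2 —
`cost_le : … lifeCost (padW (dictWT Prod.fst (R K) C.n₁) 0) (κ K q) q.2 ≤ lifeCost (padW (dictWT Prod.fst (R K) C.n₁) 0)
(costT Prod.fst C K (R K)) q.2` (and `cost_le'` with `κ'`) in place of the STEPWISE
`∀ m ∈ life (padW …) q.2, κ K q q.2 m ≤ costT Prod.fst C K (R K) q.2 m`.  Every other field (term families with the E1∕E2
representation identities, (γ) floors, site budgets, envelopes, the (2.5) size function, the memory-agnostic carrier
`realised : RealisedDomainsRW …`, `step_le`, `disjointJoins`, `boxedBirths`, the realised per-step costs `κ κ'`, the price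
sentences with the displayed discount `exp(−Ξ)`, the `Regeneration` numerator readings over the PHYSICAL member families,
NE7c's `ShellWeightBound`, NE7's `ReindexedBudget`, the four summable rates, `l₀`, `vol`) is E6's field TOKEN FOR TOKEN.
E6's witness IMPLIES this one (`CountRoadWitnessT3bW.toT`, by `lifeCostT_mono`), hence so does the landed-carrier witness
of the headline of record (`CountRoadWitnessT3b.toWT`). [folklore] -/
structure CountRoadWitnessT3bWT (D : FiniteEpsData F G) (C : T4PrintedShapeBanking.Consts) (O : PrintedO1s) (rr d n : ℕ)
    (hn : 0 < n) (g₀ : ℕ → ℝ) (os : List (ULoop F)) (ι α π : Type) [DecidableEq ι] [DecidableEq α] [DecidableEq π] :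
    Type where
  /-- the source radius -/
  l₀ : ℝ
  /-- the volume factor of the matching remainders -/
  vol : ℝ
  /-- the source radius is positive -/
  l₀_pos : 0 < l₀
  /-- the volume factor is positive -/
  vol_pos : 0 < vol
  /-- the threshold in the number of steps -/
  K₀ : ℕ
  /-- the term families -/
  T : ℕ → Finset ι
  /-- run A's term weights (`K` steps) -/
  A : ℕ → ℝ → ι → ℝ
  /-- run B's term weights (`K + 1` steps) -/
  A' : ℕ → ℝ → ι → ℝ
  /-- the two runs' shell parts (NE7c) -/
  (shA shB : ℕ → ℝ → ι → ℝ)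
  /-- the two runs' dead weights (numerator reading) -/
  (dead dead' : ℕ → ℝ → ι → ℝ)
  /-- the two runs' upper normalisation envelopes -/
  (nup mup : ℕ → ℝ → ℝ)
  /-- the common envelope bound -/
  Nup : ℝ
  /-- NE7 core budget data (`ReindexedBudget`) -/
  (Cc Rr CcRec RrRec : ℕ → ℝ → ι → ℝ)
  /-- NE7 core budget rates; `u s₂ r s` summable -/
  (ν u s₂ q₀ r s : ℕ → ℝ)
  /-- NE7c's shell weight budget -/
  Wsh : ℕ → ℝ
  /-- E1 REPRESENTATION (Bałaban's normalisation): run A's terms sum to the dressed integral of `ρ₀` after `K` steps -/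
  reprA : ∀ K t, |t| ≤ l₀ → K₀ ≤ K →
    ∫ U, Real.exp (t * T4GenFunBounds.prodObs (D.scheme g₀) K os U) * D.dens K (g₀ K) 0 U ∂fieldMeasure (F.P K) 0 G =
      ∑ τ ∈ T K, A K t τ
  /-- E2 REPRESENTATION: run B's terms sum to the dressed integral of `ρ₀` after `K + 1` steps -/
  reprB : ∀ K t, |t| ≤ l₀ → K₀ ≤ K →
    ∫ U, Real.exp (t * T4GenFunBounds.prodObs (D.scheme g₀) (K + 1) os U) * D.dens (K + 1) (g₀ (K + 1)) 0 U
        ∂fieldMeasure (F.P (K + 1)) 0 G = ∑ τ ∈ T K, A' K t τ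
  /-- the (γ) small-field mass floor -/
  c₀ : ℝ
  /-- the site budget -/
  n₁ : ℝ
  /-- the floor is positive -/
  c₀_pos : 0 < c₀
  /-- (γ) floor, run A -/
  floor : ∀ K, K₀ ≤ K → c₀ ≤ smallFieldMass D K (g₀ K)
  /-- (γ) floor, run B -/
  floor' : ∀ K, K₀ ≤ K → c₀ ≤ smallFieldMass D (K + 1) (g₀ (K + 1))
  /-- site budget, run A -/
  sites : ∀ K, K₀ ≤ K → ((D.C ⟨K, F.m, g₀ K⟩).numSites K : ℝ) ≤ n₁
  /-- site budget, run B -/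
  sites' : ∀ K, K₀ ≤ K → ((D.C ⟨K + 1, F.m, g₀ (K + 1)⟩).numSites (K + 1) : ℝ) ≤ n₁
  /-- the envelope bound is nonnegative -/
  Nup_nonneg : 0 ≤ Nup
  /-- envelope, run A -/
  nup_bd : ∀ K t, |t| ≤ l₀ → K₀ ≤ K → 0 ≤ nup K t ∧ nup K t ≤ Nup
  /-- envelope, run B -/
  mup_bd : ∀ K t, |t| ≤ l₀ → K₀ ≤ K → 0 ≤ mup K t ∧ mup K t ≤ Nup
  /-- the size function of (2.5) -/
  R : ℕ → ℕ → ℕ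
  /-- (2.5): `R K s` is an admissible size for the running coupling at step `s` -/
  isRj : ∀ K s, s ≤ K → B14.IsRj F.L rr ((D.C ⟨K, F.m, g₀ K⟩).flow.g s) (R K s)
  /-- sizes are at least one -/
  one_le_R : ∀ K, K₀ ≤ K → ∀ t, 1 ≤ R K t
  /-- H3: the reading map, pedigrees -/
  ped : ℕ → ι → Pedigree α π
  /-- H3: the reading map, root data of the live components -/
  cellP : ℕ → ι → π → Pt d × Finset (Pt d)
  /-- H3: the reading map, live components of each term -/
  liveC : ℕ → ι → Finset α
  /-- H3: the reading map, domains -/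
  Zd : ℕ → ι → α → Finset (Pt d)
  /-- H3: the pedigrees are WEAKLY (memory-agnostically) REALISED by the run's own profile with their domains:
  `real := RealisesW … ∧ PendingBefore … K` (leaf-03's IR-41-4 (3) carrier over the owner's core `RealisesW`) -/
  realised : RealisedDomainsRW F.L (runProfile F.L R) n K₀ R T ped cellP liveC Zd
  /-- H3: live components are dated no later than the cutoff -/
  step_le : ∀ K, K₀ ≤ K → ∀ τ ∈ T K, ∀ c ∈ liveC K τ, (ped K τ).step c ≤ K
  /-- H3 (row S1c-opt reading clause): DISTINCT partners at every join of a live component's member -/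
  disjointJoins : ∀ K, K₀ ≤ K → ∀ τ ∈ T K, ∀ c ∈ liveC K τ, DisjointJoins ((ped K τ).toPGen (cellP K τ) c)
  /-- H3 (row S1c-opt reading clause): constituents inside the torus' fundamental box at their birth levels -/
  boxedBirths : ∀ K, K₀ ≤ K → ∀ τ ∈ T K, ∀ c ∈ liveC K τ,
    BoxedBirths n F.L K (levelOf (runProfile F.L R K) K) ((ped K τ).toPGen (cellP K τ) c)
  /-- H3: realised per-step costs, both runs -/
  (κ κ' : ℕ → (Fin d → ℕ) × Gen (Lab α π) → Gen (Lab α π) → ℕ → ℝ)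
  /-- H3: realised LIFE cost below the model's booked LIFE cost (TOTAL form, R-OWNER-42-2), run A -/
  cost_le : ∀ K, K₀ ≤ K → ∀ τ ∈ badTerms (memOf ped liveC (cellOfR n F.L (runProfile F.L R) ped cellP)) jhalf T K, ∀ q ∈ memOf ped liveC (cellOfR n F.L (runProfile F.L R) ped cellP) K τ,
    lifeCost (padW (dictWT Prod.fst (R K) C.n₁) 0) (κ K q) q.2 ≤
      lifeCost (padW (dictWT Prod.fst (R K) C.n₁) 0) (costT Prod.fst C K (R K)) q.2
  /-- H3: realised LIFE cost below the model's booked LIFE cost (TOTAL form, R-OWNER-42-2), run B -/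
  cost_le' : ∀ K, K₀ ≤ K → ∀ τ ∈ badTerms (memOf ped liveC (cellOfR n F.L (runProfile F.L R) ped cellP)) jhalf T K, ∀ q ∈ memOf ped liveC (cellOfR n F.L (runProfile F.L R) ped cellP) K τ,
    lifeCost (padW (dictWT Prod.fst (R K) C.n₁) 0) (κ' K q) q.2 ≤
      lifeCost (padW (dictWT Prod.fst (R K) C.n₁) 0) (costT Prod.fst C K (R K)) q.2
  /-- H3: live price ∕ dead-part resummation factors of the PHYSICAL member families, both runs -/
  (FcM RfM FcM' RfM' : ℕ → Finset ((Fin d → ℕ) × Gen PEv × Multiset (PEv × ((Fin d → ℕ) × Finset (Pt d)))) → ℝ)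
  /-- H3: the per-term price sentence in print's currency WITH the displayed discount `exp(−Ξ)`, run A -/
  priceM : ∀ K t, |t| ≤ l₀ → K₀ ≤ K → ∀ τ ∈ badTerms (memOf ped liveC (cellOfR n F.L (runProfile F.L R) ped cellP)) jhalf T K,
    FcM K (kmemOf ped liveC (cellOfR n F.L (runProfile F.L R) ped cellP) (physV n F.L hn (Nat.lt_of_lt_of_le Nat.zero_lt_two (two_le_L F))
    (fun K => tcap d (dcapOf Prod.fst T (memOf ped liveC (cellOfR n F.L (runProfile F.L R) ped cellP)) K))
    (fun K => one_le_tcap d (dcapOf Prod.fst T (memOf ped liveC (cellOfR n F.L (runProfile F.L R) ped cellP)) K)) (runProfile F.L R) ped cellP) K τ) * RfM K (kmemOf ped liveC (cellOfR n F.L (runProfile F.L R) ped cellP) (physV n F.L hn (Nat.lt_of_lt_of_le Nat.zero_lt_two (two_le_L F))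
    (fun K => tcap d (dcapOf Prod.fst T (memOf ped liveC (cellOfR n F.L (runProfile F.L R) ped cellP)) K))
    (fun K => one_le_tcap d (dcapOf Prod.fst T (memOf ped liveC (cellOfR n F.L (runProfile F.L R) ped cellP)) K)) (runProfile F.L R) ped cellP) K τ) ≤
    ∏ q ∈ memOf ped liveC (cellOfR n F.L (runProfile F.L R) ped cellP) K τ,
    pshapeTH Prod.fst O C 1 1 (R K) (D.C ⟨K, F.m, g₀ K⟩).flow.g 0 (κ K q) q.2 * Real.exp (-(8 / C.E₂ * totalCostT Prod.fst C K (R K) q.2 + 4 * (partnerAges (PEv.step ∘ Prod.fst) q.2 : ℝ)))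
  /-- H3: the per-term price sentence in print's currency WITH the displayed discount `exp(−Ξ)`, run B -/
  priceM' : ∀ K t, |t| ≤ l₀ → K₀ ≤ K → ∀ τ ∈ badTerms (memOf ped liveC (cellOfR n F.L (runProfile F.L R) ped cellP)) jhalf T K,
    FcM' K (kmemOf ped liveC (cellOfR n F.L (runProfile F.L R) ped cellP) (physV n F.L hn (Nat.lt_of_lt_of_le Nat.zero_lt_two (two_le_L F))
    (fun K => tcap d (dcapOf Prod.fst T (memOf ped liveC (cellOfR n F.L (runProfile F.L R) ped cellP)) K))
    (fun K => one_le_tcap d (dcapOf Prod.fst T (memOf ped liveC (cellOfR n F.L (runProfile F.L R) ped cellP)) K)) (runProfile F.L R) ped cellP) K τ) * RfM' K (kmemOf ped liveC (cellOfR n F.L (runProfile F.L R) ped cellP) (physV n F.L hn (Nat.lt_of_lt_of_le Nat.zero_lt_two (two_le_L F))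
    (fun K => tcap d (dcapOf Prod.fst T (memOf ped liveC (cellOfR n F.L (runProfile F.L R) ped cellP)) K))
    (fun K => one_le_tcap d (dcapOf Prod.fst T (memOf ped liveC (cellOfR n F.L (runProfile F.L R) ped cellP)) K)) (runProfile F.L R) ped cellP) K τ) ≤
    ∏ q ∈ memOf ped liveC (cellOfR n F.L (runProfile F.L R) ped cellP) K τ,
    pshapeTH Prod.fst O C 1 1 (R K) (D.C ⟨K, F.m, g₀ K⟩).flow.g 0 (κ' K q) q.2 * Real.exp (-(8 / C.E₂ * totalCostT Prod.fst C K (R K) q.2 + 4 * (partnerAges (PEv.step ∘ Prod.fst) q.2 : ℝ)))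
  /-- H3 numerator reading, run A: terms below dead weight × live price of the physical member family × envelope -/
  upM : ∀ K t, |t| ≤ l₀ → K₀ ≤ K →
    ∀ k ∈ badGMems (memOf ped liveC (cellOfR n F.L (runProfile F.L R) ped cellP)) jhalf T (kmemOf ped liveC (cellOfR n F.L (runProfile F.L R) ped cellP) (physV n F.L hn (Nat.lt_of_lt_of_le Nat.zero_lt_two (two_le_L F))
    (fun K => tcap d (dcapOf Prod.fst T (memOf ped liveC (cellOfR n F.L (runProfile F.L R) ped cellP)) K))
    (fun K => one_le_tcap d (dcapOf Prod.fst T (memOf ped liveC (cellOfR n F.L (runProfile F.L R) ped cellP)) K)) (runProfile F.L R) ped cellP)) K,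
    ∀ τ ∈ fibre (kmemOf ped liveC (cellOfR n F.L (runProfile F.L R) ped cellP) (physV n F.L hn (Nat.lt_of_lt_of_le Nat.zero_lt_two (two_le_L F))
    (fun K => tcap d (dcapOf Prod.fst T (memOf ped liveC (cellOfR n F.L (runProfile F.L R) ped cellP)) K))
    (fun K => one_le_tcap d (dcapOf Prod.fst T (memOf ped liveC (cellOfR n F.L (runProfile F.L R) ped cellP)) K)) (runProfile F.L R) ped cellP)) T K k, A K t τ ≤ dead K t τ * FcM K k * nup K t
  /-- H3 numerator reading, run A: dead weights nonnegative -/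
  deadM_nonneg : ∀ K t, |t| ≤ l₀ → K₀ ≤ K →
    ∀ k ∈ badGMems (memOf ped liveC (cellOfR n F.L (runProfile F.L R) ped cellP)) jhalf T (kmemOf ped liveC (cellOfR n F.L (runProfile F.L R) ped cellP) (physV n F.L hn (Nat.lt_of_lt_of_le Nat.zero_lt_two (two_le_L F))
    (fun K => tcap d (dcapOf Prod.fst T (memOf ped liveC (cellOfR n F.L (runProfile F.L R) ped cellP)) K))
    (fun K => one_le_tcap d (dcapOf Prod.fst T (memOf ped liveC (cellOfR n F.L (runProfile F.L R) ped cellP)) K)) (runProfile F.L R) ped cellP)) K,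
    ∀ τ ∈ fibre (kmemOf ped liveC (cellOfR n F.L (runProfile F.L R) ped cellP) (physV n F.L hn (Nat.lt_of_lt_of_le Nat.zero_lt_two (two_le_L F))
    (fun K => tcap d (dcapOf Prod.fst T (memOf ped liveC (cellOfR n F.L (runProfile F.L R) ped cellP)) K))
    (fun K => one_le_tcap d (dcapOf Prod.fst T (memOf ped liveC (cellOfR n F.L (runProfile F.L R) ped cellP)) K)) (runProfile F.L R) ped cellP)) T K k, 0 ≤ dead K t τ
  /-- H3 numerator reading, run A: the dead-part resummation over terms with EQUAL physical live data -/
  resumM : ∀ K t, |t| ≤ l₀ → K₀ ≤ K →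
    ∀ k ∈ badGMems (memOf ped liveC (cellOfR n F.L (runProfile F.L R) ped cellP)) jhalf T (kmemOf ped liveC (cellOfR n F.L (runProfile F.L R) ped cellP) (physV n F.L hn (Nat.lt_of_lt_of_le Nat.zero_lt_two (two_le_L F))
    (fun K => tcap d (dcapOf Prod.fst T (memOf ped liveC (cellOfR n F.L (runProfile F.L R) ped cellP)) K))
    (fun K => one_le_tcap d (dcapOf Prod.fst T (memOf ped liveC (cellOfR n F.L (runProfile F.L R) ped cellP)) K)) (runProfile F.L R) ped cellP)) K,
    ∑ τ ∈ fibre (kmemOf ped liveC (cellOfR n F.L (runProfile F.L R) ped cellP) (physV n F.L hn (Nat.lt_of_lt_of_le Nat.zero_lt_two (two_le_L F))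
    (fun K => tcap d (dcapOf Prod.fst T (memOf ped liveC (cellOfR n F.L (runProfile F.L R) ped cellP)) K))
    (fun K => one_le_tcap d (dcapOf Prod.fst T (memOf ped liveC (cellOfR n F.L (runProfile F.L R) ped cellP)) K)) (runProfile F.L R) ped cellP)) T K k, dead K t τ ≤ RfM K k
  /-- H3 numerator reading, run A: live prices nonnegative -/
  FM_nonneg : ∀ K t, |t| ≤ l₀ → K₀ ≤ K →
    ∀ k ∈ badGMems (memOf ped liveC (cellOfR n F.L (runProfile F.L R) ped cellP)) jhalf T (kmemOf ped liveC (cellOfR n F.L (runProfile F.L R) ped cellP) (physV n F.L hn (Nat.lt_of_lt_of_le Nat.zero_lt_two (two_le_L F))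
    (fun K => tcap d (dcapOf Prod.fst T (memOf ped liveC (cellOfR n F.L (runProfile F.L R) ped cellP)) K))
    (fun K => one_le_tcap d (dcapOf Prod.fst T (memOf ped liveC (cellOfR n F.L (runProfile F.L R) ped cellP)) K)) (runProfile F.L R) ped cellP)) K, 0 ≤ FcM K k
  /-- H3 numerator reading, run B -/
  upM' : ∀ K t, |t| ≤ l₀ → K₀ ≤ K →
    ∀ k ∈ badGMems (memOf ped liveC (cellOfR n F.L (runProfile F.L R) ped cellP)) jhalf T (kmemOf ped liveC (cellOfR n F.L (runProfile F.L R) ped cellP) (physV n F.L hn (Nat.lt_of_lt_of_le Nat.zero_lt_two (two_le_L F))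
    (fun K => tcap d (dcapOf Prod.fst T (memOf ped liveC (cellOfR n F.L (runProfile F.L R) ped cellP)) K))
    (fun K => one_le_tcap d (dcapOf Prod.fst T (memOf ped liveC (cellOfR n F.L (runProfile F.L R) ped cellP)) K)) (runProfile F.L R) ped cellP)) K,
    ∀ τ ∈ fibre (kmemOf ped liveC (cellOfR n F.L (runProfile F.L R) ped cellP) (physV n F.L hn (Nat.lt_of_lt_of_le Nat.zero_lt_two (two_le_L F))
    (fun K => tcap d (dcapOf Prod.fst T (memOf ped liveC (cellOfR n F.L (runProfile F.L R) ped cellP)) K))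
    (fun K => one_le_tcap d (dcapOf Prod.fst T (memOf ped liveC (cellOfR n F.L (runProfile F.L R) ped cellP)) K)) (runProfile F.L R) ped cellP)) T K k, A' K t τ ≤ dead' K t τ * FcM' K k * mup K t
  /-- H3 numerator reading, run B -/
  deadM'_nonneg : ∀ K t, |t| ≤ l₀ → K₀ ≤ K →
    ∀ k ∈ badGMems (memOf ped liveC (cellOfR n F.L (runProfile F.L R) ped cellP)) jhalf T (kmemOf ped liveC (cellOfR n F.L (runProfile F.L R) ped cellP) (physV n F.L hn (Nat.lt_of_lt_of_le Nat.zero_lt_two (two_le_L F))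
    (fun K => tcap d (dcapOf Prod.fst T (memOf ped liveC (cellOfR n F.L (runProfile F.L R) ped cellP)) K))
    (fun K => one_le_tcap d (dcapOf Prod.fst T (memOf ped liveC (cellOfR n F.L (runProfile F.L R) ped cellP)) K)) (runProfile F.L R) ped cellP)) K,
    ∀ τ ∈ fibre (kmemOf ped liveC (cellOfR n F.L (runProfile F.L R) ped cellP) (physV n F.L hn (Nat.lt_of_lt_of_le Nat.zero_lt_two (two_le_L F))
    (fun K => tcap d (dcapOf Prod.fst T (memOf ped liveC (cellOfR n F.L (runProfile F.L R) ped cellP)) K))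
    (fun K => one_le_tcap d (dcapOf Prod.fst T (memOf ped liveC (cellOfR n F.L (runProfile F.L R) ped cellP)) K)) (runProfile F.L R) ped cellP)) T K k, 0 ≤ dead' K t τ
  /-- H3 numerator reading, run B -/
  resumM' : ∀ K t, |t| ≤ l₀ → K₀ ≤ K →
    ∀ k ∈ badGMems (memOf ped liveC (cellOfR n F.L (runProfile F.L R) ped cellP)) jhalf T (kmemOf ped liveC (cellOfR n F.L (runProfile F.L R) ped cellP) (physV n F.L hn (Nat.lt_of_lt_of_le Nat.zero_lt_two (two_le_L F))
    (fun K => tcap d (dcapOf Prod.fst T (memOf ped liveC (cellOfR n F.L (runProfile F.L R) ped cellP)) K))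
    (fun K => one_le_tcap d (dcapOf Prod.fst T (memOf ped liveC (cellOfR n F.L (runProfile F.L R) ped cellP)) K)) (runProfile F.L R) ped cellP)) K,
    ∑ τ ∈ fibre (kmemOf ped liveC (cellOfR n F.L (runProfile F.L R) ped cellP) (physV n F.L hn (Nat.lt_of_lt_of_le Nat.zero_lt_two (two_le_L F))
    (fun K => tcap d (dcapOf Prod.fst T (memOf ped liveC (cellOfR n F.L (runProfile F.L R) ped cellP)) K))
    (fun K => one_le_tcap d (dcapOf Prod.fst T (memOf ped liveC (cellOfR n F.L (runProfile F.L R) ped cellP)) K)) (runProfile F.L R) ped cellP)) T K k, dead' K t τ ≤ RfM' K k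
  /-- H3 numerator reading, run B -/
  FM'_nonneg : ∀ K t, |t| ≤ l₀ → K₀ ≤ K →
    ∀ k ∈ badGMems (memOf ped liveC (cellOfR n F.L (runProfile F.L R) ped cellP)) jhalf T (kmemOf ped liveC (cellOfR n F.L (runProfile F.L R) ped cellP) (physV n F.L hn (Nat.lt_of_lt_of_le Nat.zero_lt_two (two_le_L F))
    (fun K => tcap d (dcapOf Prod.fst T (memOf ped liveC (cellOfR n F.L (runProfile F.L R) ped cellP)) K))
    (fun K => one_le_tcap d (dcapOf Prod.fst T (memOf ped liveC (cellOfR n F.L (runProfile F.L R) ped cellP)) K)) (runProfile F.L R) ped cellP)) K, 0 ≤ FcM' K k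
  /-- NE7c: the indicator shells' relative weight bound -/
  shell : ShellWeightBound l₀ T A A' shA shB Wsh
  /-- NE7: the core budget on the hybrid cores over the bad classes -/
  budget : ReindexedBudget l₀ vol T (fun K t τ => A K t τ - shA K t τ) (fun K t τ => A' K t τ - shB K t τ)
    (badOfClass (bstrOf Prod.fst (memOf ped liveC (cellOfR n F.L (runProfile F.L R) ped cellP))) T
    (fun K _ => badClasses Prod.fst (memOf ped liveC (cellOfR n F.L (runProfile F.L R) ped cellP)) jhalf T K)) Cc Rr CcRec RrRec ν u s₂ q₀ r s
  /-- summable rates -/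
  sum_r : Summable r
  /-- summable rates -/
  sum_u : Summable u
  /-- summable rates -/
  sum_s : Summable s
  /-- summable rates -/
  sum_s₂ : Summable s₂

omit [RegularGaugeGroup G] in
/-- **E6's WITNESS IMPLIES THE TOTAL-FORM ONE**: every field copied, the two cost fields through
`HistoryConstants.lifeCostT_mono` (`= Finset.sum_le_sum`: a STEPWISE domination on the padded life sums to the TOTAL
one).  Hence every consequence drawn from a `CountRoadWitnessT3bWT` (the total-form W-headline to come, file E8T) applies
to E6's witnesses, i.e. to the hypothesis of the W-headline E8 (p255842). [folklore] -/
def CountRoadWitnessT3bW.toT {D : FiniteEpsData F G} {C : T4PrintedShapeBanking.Consts} {O : PrintedO1s} {rr d n : ℕ}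
    {hn : 0 < n} {g₀ : ℕ → ℝ} {os : List (ULoop F)} {ι α π : Type} [DecidableEq ι] [DecidableEq α] [DecidableEq π]
    (X : CountRoadWitnessT3bW D C O rr d n hn g₀ os ι α π) : CountRoadWitnessT3bWT D C O rr d n hn g₀ os ι α π :=
  { l₀ := X.l₀, vol := X.vol, l₀_pos := X.l₀_pos, vol_pos := X.vol_pos, K₀ := X.K₀, T := X.T, A := X.A, A' := X.A',
    shA := X.shA, shB := X.shB, dead := X.dead, dead' := X.dead', nup := X.nup, mup := X.mup, Nup := X.Nup, Cc :=
    X.Cc, Rr := X.Rr, CcRec := X.CcRec, RrRec := X.RrRec, ν := X.ν, u := X.u, s₂ := X.s₂, q₀ := X.q₀, r := X.r, s :=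
    X.s, Wsh := X.Wsh, reprA := X.reprA, reprB := X.reprB, c₀ := X.c₀, n₁ := X.n₁, c₀_pos := X.c₀_pos, floor :=
    X.floor, floor' := X.floor', sites := X.sites, sites' := X.sites', Nup_nonneg := X.Nup_nonneg, nup_bd :=
    X.nup_bd, mup_bd := X.mup_bd, R := X.R, isRj := X.isRj, one_le_R := X.one_le_R, ped := X.ped, cellP := X.cellP,
    liveC := X.liveC, Zd := X.Zd, realised := X.realised, step_le := X.step_le, disjointJoins := X.disjointJoins,
    boxedBirths := X.boxedBirths, κ := X.κ, κ' := X.κ',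
    cost_le := fun K hK τ hτ q hq => lifeCostT_mono (X.cost_le K hK τ hτ q hq),
    cost_le' := fun K hK τ hτ q hq => lifeCostT_mono (X.cost_le' K hK τ hτ q hq),
    FcM := X.FcM, RfM := X.RfM, FcM' := X.FcM', RfM' := X.RfM', priceM := X.priceM, priceM' := X.priceM', upM := X.upM,
    deadM_nonneg := X.deadM_nonneg, resumM := X.resumM, FM_nonneg := X.FM_nonneg, upM' := X.upM', deadM'_nonneg :=
    X.deadM'_nonneg, resumM' := X.resumM', FM'_nonneg := X.FM'_nonneg, shell := X.shell, budget := X.budget, sum_r :=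
    X.sum_r, sum_u := X.sum_u, sum_s := X.sum_s, sum_s₂ := X.sum_s₂ }

omit [RegularGaugeGroup G] in
/-- **THE LANDED-CARRIER WITNESS OF THE HEADLINE OF RECORD IMPLIES THE TOTAL-FORM ONE**: E6's bridge
`CountRoadWitnessT3b.toW` (carrier `RealisedDomainsR.toW`) followed by `CountRoadWitnessT3bW.toT` (cost side).  Hence every
consequence drawn from a `CountRoadWitnessT3bWT` applies to the witnesses of the headline of record p224237. [folklore] -/
def CountRoadWitnessT3b.toWT {D : FiniteEpsData F G} {C : T4PrintedShapeBanking.Consts} {O : PrintedO1s} {rr d n : ℕ}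
    {hn : 0 < n} {g₀ : ℕ → ℝ} {os : List (ULoop F)} {ι α π : Type} [DecidableEq ι] [DecidableEq α] [DecidableEq π]
    (X : CountRoadWitnessT3b D C O rr d n hn g₀ os ι α π) : CountRoadWitnessT3bWT D C O rr d n hn g₀ os ι α π :=
  CountRoadWitnessT3bW.toT (CountRoadWitnessT3b.toW X)

/-! ## §2 The per-string datum, read off a total-form witness -/

omit [RegularGaugeGroup G] in
/-- **ONE STRING: END v3′ ⇒ THE APEX'S PER-STRING HYBRID-NE7 DATUM, read off a total-form memory-agnostic witness** — the
landed, structure-free `HistoryRealiseCellsRunApexT3b.stringHybridNE7_of_hybridNE7_repr` (BY NAME) with the data and the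
E1∕E2 identities of a `CountRoadWitnessT3bWT` (twin of E6's `stringHybridNE7_of_hybridNE7T3bW`; neither the `realised`
field nor the cost fields are read here). [folklore] -/
theorem stringHybridNE7_of_hybridNE7T3bWT (D : FiniteEpsData F G) {C : T4PrintedShapeBanking.Consts} {O : PrintedO1s}
    {rr d n : ℕ} {hn : 0 < n} {g₀ : ℕ → ℝ} {os : List (ULoop F)} {ι α π : Type} [DecidableEq ι] [DecidableEq α]
    [DecidableEq π] (X : CountRoadWitnessT3bWT D C O rr d n hn g₀ os ι α π) {Bad : ℕ → ℝ → Finset ι} {W δ : ℕ → ℝ}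
    {K₁ K₂ : ℕ} (hK : X.K₀ ≤ K₁)
    (hH : HybridNE7 X.l₀ X.vol (fun K => X.T (K₁ + (K₂ + K))) (fun K => X.A (K₁ + (K₂ + K)))
      (fun K => X.A' (K₁ + (K₂ + K))) Bad W (fun K => X.shA (K₁ + (K₂ + K))) (fun K => X.shB (K₁ + (K₂ + K)))
      (fun K => X.Wsh (K₁ + (K₂ + K))) δ) :
    StringHybridNE7 (D.scheme g₀) os X.l₀ X.vol (K₁ + K₂) :=
  stringHybridNE7_of_hybridNE7_repr D X.reprA X.reprB hK hH

omit [RegularGaugeGroup G] in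
/-- sanity of the bridge `toT`: the data fields and the carrier field are untouched (definitional) [folklore] -/
theorem CountRoadWitnessT3bW.toT_data {D : FiniteEpsData F G} {C : T4PrintedShapeBanking.Consts} {O : PrintedO1s}
    {rr d n : ℕ} {hn : 0 < n} {g₀ : ℕ → ℝ} {os : List (ULoop F)} {ι α π : Type} [DecidableEq ι] [DecidableEq α]
    [DecidableEq π] (X : CountRoadWitnessT3bW D C O rr d n hn g₀ os ι α π) :
    (CountRoadWitnessT3bW.toT X).l₀ = X.l₀ ∧ (CountRoadWitnessT3bW.toT X).vol = X.vol ∧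
      (CountRoadWitnessT3bW.toT X).K₀ = X.K₀ ∧ (CountRoadWitnessT3bW.toT X).T = X.T ∧
      (CountRoadWitnessT3bW.toT X).A = X.A ∧ (CountRoadWitnessT3bW.toT X).A' = X.A' ∧
      (CountRoadWitnessT3bW.toT X).R = X.R ∧ (CountRoadWitnessT3bW.toT X).ped = X.ped ∧
      (CountRoadWitnessT3bW.toT X).κ = X.κ ∧ (CountRoadWitnessT3bW.toT X).κ' = X.κ' ∧
      (CountRoadWitnessT3bW.toT X).realised = X.realised :=
  ⟨rfl, rfl, rfl, rfl, rfl, rfl, rfl, rfl, rfl, rfl, rfl⟩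

omit [RegularGaugeGroup G] in
/-- sanity of the bridge `toWT`: the data fields are untouched (definitional) [folklore] -/
theorem CountRoadWitnessT3b.toWT_data {D : FiniteEpsData F G} {C : T4PrintedShapeBanking.Consts} {O : PrintedO1s}
    {rr d n : ℕ} {hn : 0 < n} {g₀ : ℕ → ℝ} {os : List (ULoop F)} {ι α π : Type} [DecidableEq ι] [DecidableEq α]
    [DecidableEq π] (X : CountRoadWitnessT3b D C O rr d n hn g₀ os ι α π) :
    (CountRoadWitnessT3b.toWT X).l₀ = X.l₀ ∧ (CountRoadWitnessT3b.toWT X).vol = X.vol ∧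
      (CountRoadWitnessT3b.toWT X).K₀ = X.K₀ ∧ (CountRoadWitnessT3b.toWT X).T = X.T ∧
      (CountRoadWitnessT3b.toWT X).A = X.A ∧ (CountRoadWitnessT3b.toWT X).A' = X.A' :=
  ⟨rfl, rfl, rfl, rfl, rfl, rfl⟩

/-! ## §3 The stepwise reading is an instance of the total one (kernel-checked round trip) -/

/- From a STEPWISE cost domination on the padded life of every live member (E6's field shape, binders VERBATIM) the
TOTAL-form field of `CountRoadWitnessT3bWT` follows by `lifeCostT_mono` — the content of `toT`'s two cost entries,
displayed once as a stand-alone `example` so that a reader sees the one inequality that changed. [folklore] -/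
example {C : T4PrintedShapeBanking.Consts} {d n : ℕ} {ι α π : Type} [DecidableEq α] [DecidableEq π] {K₀ : ℕ}
    {T : ℕ → Finset ι} {R : ℕ → ℕ → ℕ} {ped : ℕ → ι → Pedigree α π} {cellP : ℕ → ι → π → Pt d × Finset (Pt d)}
    {liveC : ℕ → ι → Finset α} {κ : ℕ → (Fin d → ℕ) × Gen (Lab α π) → Gen (Lab α π) → ℕ → ℝ}
    (h : ∀ K, K₀ ≤ K → ∀ τ ∈ badTerms (memOf ped liveC (cellOfR n F.L (runProfile F.L R) ped cellP)) jhalf T K,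
      ∀ q ∈ memOf ped liveC (cellOfR n F.L (runProfile F.L R) ped cellP) K τ,
      ∀ m ∈ life (padW (dictWT Prod.fst (R K) C.n₁) 0) q.2, κ K q q.2 m ≤ costT Prod.fst C K (R K) q.2 m) :
    ∀ K, K₀ ≤ K → ∀ τ ∈ badTerms (memOf ped liveC (cellOfR n F.L (runProfile F.L R) ped cellP)) jhalf T K,
      ∀ q ∈ memOf ped liveC (cellOfR n F.L (runProfile F.L R) ped cellP) K τ,
      lifeCost (padW (dictWT Prod.fst (R K) C.n₁) 0) (κ K q) q.2 ≤
        lifeCost (padW (dictWT Prod.fst (R K) C.n₁) 0) (costT Prod.fst C K (R K)) q.2 :=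
  fun K hK τ hτ q hq => lifeCostT_mono (h K hK τ hτ q hq)

end Apex

end

end Summit.QuantumFields.BalabanUV.T4Continuum.HistoryRealiseCellsRunApexT3bWT
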